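import Summits.AtomisticToContinuum.HydrodynamicLimit.Theorems.TwoClocksEquilibriumFastWindowLDBirthT12Legendre
import HarnessLib

/-!
# The certified Legendre number of the far-field iterate: `Σ_{ℓ ≥ 2} c_ℓ μ_ℓ⁸ ≤ 2/3 < 1`
# (FF4 of plan §6 of the registered sub-goal `t12_logLinearPreimage_and_dipoleModulus`, line `birth`,
# crux `TwoClocks.EquilibriumFastWindowLD`, stmt-AtomisticToContinuum-14440; infrastructure file 4)

Plan §6 controls the `k`-fold far-field gain iterate on the `ℓ ≥ 2` functions of `L^∞(S²)` by
the Legendre series `θ_k ≤ Σ_{ℓ ≥ 2} c_ℓ μ_ℓ^k` with the weights and one-step constants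
`c_ℓ := (2ℓ+1)/2 · ‖P_ℓ‖_{L¹[-1,1]}`, `μ_ℓ := 4 ∫₀¹ ρ² |P_ℓ(ρ)| dρ` (`P_ℓ` the tree's Rodrigues
Legendre polynomial `Literature.Analysis.SpecialFunctions.legendre ℓ`), and needs ONE certified
number `θ_k < 1` (FF4). Numerically `θ_5 ≈ 0.55`, `θ_6 ≈ 0.26`, `θ_8 ≈ 0.077`; the point of this
file is that for **`k = 8` the two elementary Cauchy–Schwarz bounds already landed in
`…BirthT12Legendre`** — `‖P_ℓ‖₁ ≤ 2/√(2ℓ+1)` (`integral_abs_legendre_le`) and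
`μ_ℓ ≤ 4/√(5(2ℓ+1))` (`four_mul_integral_sq_mul_abs_legendre_le`) — certify `θ_8 < 1` for ALL
`ℓ ≥ 2` at once, with no head values, no root isolation and no real powers:

* `cWeight_mul_mu_pow_eight_le` — with `m = 2ℓ+1`: `c_ℓ ≤ √m ≤ (m+9)/6` (AM–GM at `√m ≈ 3`) and
  `μ_ℓ⁸ = (μ_ℓ²)⁴ ≤ (16/(5m))⁴`, so `c_ℓ μ_ℓ⁸ ≤ T(ℓ) := (65536/3750) (m+9)/m⁴`, a rational majorant;
* `sum_legendreMajorant_le` — `Σ_{ℓ=2}^{N} T(ℓ) ≤ 2/3` for every `N`: the four head terms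
  `T(2)+T(3)+T(4)+T(5) = 0.57974…` are evaluated in `ℚ`, and for `ℓ ≥ 6` the telescoping
  `T(ℓ) ≤ (5/2)(1/ℓ² - 1/(ℓ+1)²)` (a degree-5 polynomial inequality with positive coefficients in
  `ℓ - 6`) bounds the tail by `(5/2)/36`; `0.5797 + 0.0695 ≤ 2/3`;
* **`t12_farField_legendreCertificate`** (registered helper) — the certificate itself, as the
  uniform bound `Σ_{ℓ=2}^{N+1} c_ℓ μ_ℓ⁸ ≤ 2/3` on all partial sums (index shifted to `ℓ + 2`), and
  `t12_farField_legendreCertificate_tsum` — the same for the series: it is summable with sum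
  `≤ 2/3` (nonnegative terms).

So the crude EIGHT-step far-field iterate contracts on the sector `ℓ ≥ 2` with ratio `≤ 2/3`
(the analytic value of the majorant series is `0.6248…`, of `θ_8` itself `0.077`). Deciding
numerics (exact rationals, `work/stubs/scratch/ff4/`): with only these two bounds `k = 6` does NOT
certify without head values (`1.32`), `k = 7` barely (`0.87`), `k = 8` comfortably (`0.604`).

NOT here: the sharper moments `∫ x² P_n²` (sibling file), exact head values `ℓ ≥ 4`, `k = 6`.
-/

noncomputable section

open MeasureTheory Real Set intervalIntegral Polynomial
namespace Summit.AtomisticToContinuum.HydrodynamicLimit.Theorems.ClampedCorrectorBirth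
open Literature.Analysis.SpecialFunctions

/-! ### Signs -/

/-- `0 ≤ ‖P_n‖_{L¹[-1,1]}`. [folklore] -/
theorem integral_abs_legendre_nonneg (n : ℕ) : 0 ≤ ∫ x in (-1 : ℝ)..1, |(legendre n).eval x| :=
  intervalIntegral.integral_nonneg (by norm_num) fun x _ => abs_nonneg _

/-- `0 ≤ μ_n = 4 ∫₀¹ ρ² |P_n(ρ)| dρ`. [folklore] -/
theorem four_mul_integral_sq_mul_abs_legendre_nonneg (n : ℕ) :
    0 ≤ 4 * ∫ ρ in (0 : ℝ)..1, ρ ^ 2 * |(legendre n).eval ρ| :=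
  mul_nonneg (by norm_num) (intervalIntegral.integral_nonneg zero_le_one fun ρ _ => by positivity)

/-- `0 ≤ c_n μ_n⁸`: the terms of the Legendre series are nonnegative. [folklore] -/
theorem cWeight_mul_mu_pow_eight_nonneg (n : ℕ) :
    0 ≤ (2 * (n : ℝ) + 1) / 2 * (∫ x in (-1 : ℝ)..1, |(legendre n).eval x|) *
      (4 * ∫ ρ in (0 : ℝ)..1, ρ ^ 2 * |(legendre n).eval ρ|) ^ 8 :=
  mul_nonneg (mul_nonneg (by positivity) (integral_abs_legendre_nonneg n))
    (pow_nonneg (four_mul_integral_sq_mul_abs_legendre_nonneg n) 8)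

/-! ### The rational majorant of one term -/

/-- **`c_n μ_n⁸ ≤ T(n) := (65536/3750) · (2n+10)/(2n+1)⁴`** for every `n`: with `m = 2n+1`,
`c_n = (m/2)‖P_n‖₁ ≤ (m/2)(2/√m) = √m ≤ (m+9)/6` (AM–GM) and
`μ_n⁸ ≤ (4/√(5m))⁸ = 65536/(625 m⁴)` (the two Cauchy–Schwarz tail bounds of `…BirthT12Legendre`).
[folklore] -/
theorem cWeight_mul_mu_pow_eight_le (n : ℕ) :
    (2 * (n : ℝ) + 1) / 2 * (∫ x in (-1 : ℝ)..1, |(legendre n).eval x|) *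
        (4 * ∫ ρ in (0 : ℝ)..1, ρ ^ 2 * |(legendre n).eval ρ|) ^ 8 ≤
      65536 / 3750 * (2 * (n : ℝ) + 10) / (2 * (n : ℝ) + 1) ^ 4 := by
  have e10 : 2 * (n : ℝ) + 10 = (2 * (n : ℝ) + 1) + 9 := by ring
  rw [e10]
  set m : ℝ := 2 * n + 1 with hm
  set I : ℝ := ∫ x in (-1 : ℝ)..1, |(legendre n).eval x| with hI
  set μ : ℝ := 4 * ∫ ρ in (0 : ℝ)..1, ρ ^ 2 * |(legendre n).eval ρ| with hμ
  have hm0 : 0 < m := by positivity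
  have hμ0 : 0 ≤ μ := four_mul_integral_sq_mul_abs_legendre_nonneg n
  have h1 : I ≤ 2 / Real.sqrt m := integral_abs_legendre_le n
  have h2 : μ ≤ 4 / Real.sqrt (5 * m) := four_mul_integral_sq_mul_abs_legendre_le n
  have hs : Real.sqrt m ^ 2 = m := Real.sq_sqrt hm0.le
  have hs5 : Real.sqrt (5 * m) ^ 2 = 5 * m := Real.sq_sqrt (by positivity)
  -- `μ⁸ ≤ 65536/(625 m⁴)`
  have h3 : μ ^ 8 ≤ 65536 / (625 * m ^ 4) := by
    calc μ ^ 8 ≤ (4 / Real.sqrt (5 * m)) ^ 8 := pow_le_pow_left₀ hμ0 h2 8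
      _ = 65536 / (625 * m ^ 4) := by
          rw [div_pow, show Real.sqrt (5 * m) ^ 8 = (Real.sqrt (5 * m) ^ 2) ^ 4 by ring, hs5]
          ring
  -- `c ≤ √m ≤ (m+9)/6`
  have h4 : m / 2 * I ≤ (m + 9) / 6 := by
    calc m / 2 * I ≤ m / 2 * (2 / Real.sqrt m) := by gcongr
      _ = m / Real.sqrt m := by ring
      _ = Real.sqrt m := Real.div_sqrt
      _ ≤ (m + 9) / 6 := by nlinarith [sq_nonneg (Real.sqrt m - 3), Real.sqrt_nonneg m]
  calc m / 2 * I * μ ^ 8 ≤ (m + 9) / 6 * (65536 / (625 * m ^ 4)) :=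
        mul_le_mul h4 h3 (pow_nonneg hμ0 8) (by positivity)
    _ = 65536 / 3750 * (m + 9) / m ^ 4 := by
        field_simp
        ring

/-! ### The majorant series -/

/-- Telescoping step of the tail: `T(k+6) ≤ (5/2)/(k+6)² - (5/2)/(k+7)²` for all `k ≥ 0` — after
clearing denominators, a quintic in `k` with positive coefficients. [folklore] -/
theorem legendreMajorant_step (k : ℕ) :
    65536 / 3750 * (2 * ((k : ℝ) + 6) + 10) / (2 * ((k : ℝ) + 6) + 1) ^ 4 ≤
      5 / 2 / ((k : ℝ) + 6) ^ 2 - 5 / 2 / ((k : ℝ) + 7) ^ 2 := by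
  rw [← sub_nonneg]
  have e : 5 / 2 / ((k : ℝ) + 6) ^ 2 - 5 / 2 / ((k : ℝ) + 7) ^ 2 -
      65536 / 3750 * (2 * ((k : ℝ) + 6) + 10) / (2 * ((k : ℝ) + 6) + 1) ^ 4 =
      (1875101574 + 1743891756 * (k : ℝ) + 631942000 * (k : ℝ) ^ 2 + 112204384 * (k : ℝ) ^ 3 +
          9800672 * (k : ℝ) ^ 4 + 337856 * (k : ℝ) ^ 5) /
        (7500 * ((k : ℝ) + 6) ^ 2 * ((k : ℝ) + 7) ^ 2 * (2 * ((k : ℝ) + 6) + 1) ^ 4) := by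
    field_simp
    ring
  rw [e]
  positivity

/-- **The majorant series: `Σ_{ℓ < N} T(ℓ+2) ≤ 2/3` for every `N`.** Head `T(2)+…+T(5)` in `ℚ`
(`= 0.57974…`), tail `Σ_{ℓ ≥ 6} T(ℓ) ≤ (5/2)/36` by `legendreMajorant_step`. [folklore] -/
theorem sum_legendreMajorant_le (N : ℕ) :
    ∑ ℓ ∈ Finset.range N,
        65536 / 3750 * (2 * ((ℓ + 2 : ℕ) : ℝ) + 10) / (2 * ((ℓ + 2 : ℕ) : ℝ) + 1) ^ 4 ≤ 2 / 3 := by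
  -- for `N ≥ 4`: partial sum `≤ 2/3 - (5/2)/(N+2)²`
  have key : ∀ M : ℕ, 4 ≤ M → ∑ ℓ ∈ Finset.range M,
      65536 / 3750 * (2 * ((ℓ + 2 : ℕ) : ℝ) + 10) / (2 * ((ℓ + 2 : ℕ) : ℝ) + 1) ^ 4 ≤
        2 / 3 - 5 / 2 / ((M : ℝ) + 2) ^ 2 := by
    intro M hM
    induction M, hM using Nat.le_induction with
    | base =>
        simp only [Finset.sum_range_succ, Finset.sum_range_zero]
        norm_num
    | succ M hM ih =>
        rw [Finset.sum_range_succ]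
        obtain ⟨k, rfl⟩ : ∃ k, M = k + 4 := ⟨M - 4, by omega⟩
        have hstep := legendreMajorant_step k
        have e1 : (2 * ((k + 4 + 2 : ℕ) : ℝ) + 10) = 2 * ((k : ℝ) + 6) + 10 := by push_cast; ring
        have e2 : (2 * ((k + 4 + 2 : ℕ) : ℝ) + 1) = 2 * ((k : ℝ) + 6) + 1 := by push_cast; ring
        have e3 : ((k + 4 : ℕ) : ℝ) + 2 = (k : ℝ) + 6 := by push_cast; ring
        have e4 : ((k + 4 + 1 : ℕ) : ℝ) + 2 = (k : ℝ) + 7 := by push_cast; ring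
        rw [e1, e2, e4]
        rw [e3] at ih
        linarith
  have hT : ∀ ℓ : ℕ,
      0 ≤ 65536 / 3750 * (2 * ((ℓ + 2 : ℕ) : ℝ) + 10) / (2 * ((ℓ + 2 : ℕ) : ℝ) + 1) ^ 4 :=
    fun ℓ => by positivity
  rcases le_or_gt 4 N with hN | hN
  · have h := key N hN
    have : (0 : ℝ) ≤ 5 / 2 / ((N : ℝ) + 2) ^ 2 := by positivity
    linarith
  · calc ∑ ℓ ∈ Finset.range N,
          65536 / 3750 * (2 * ((ℓ + 2 : ℕ) : ℝ) + 10) / (2 * ((ℓ + 2 : ℕ) : ℝ) + 1) ^ 4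
        ≤ ∑ ℓ ∈ Finset.range 4,
          65536 / 3750 * (2 * ((ℓ + 2 : ℕ) : ℝ) + 10) / (2 * ((ℓ + 2 : ℕ) : ℝ) + 1) ^ 4 :=
          Finset.sum_le_sum_of_subset_of_nonneg (Finset.range_mono hN.le) fun ℓ _ _ => hT ℓ
      _ ≤ 2 / 3 - 5 / 2 / (((4 : ℕ) : ℝ) + 2) ^ 2 := key 4 le_rfl
      _ ≤ 2 / 3 := by norm_num

/-! ### The certificate -/

/-- **FF4, the certified Legendre number of the eight-step far-field iterate:
`Σ_{2 ≤ ℓ ≤ N+1} c_ℓ μ_ℓ⁸ ≤ 2/3 < 1` for every `N`**, with `c_ℓ = (2ℓ+1)/2 · ∫_{-1}^{1} |P_ℓ|` and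
`μ_ℓ = 4 ∫₀¹ ρ² |P_ℓ(ρ)| dρ` (plan §6 of `t12_logLinearPreimage_and_dipoleModulus`: the crude
`k`-step angular contraction number `θ_k ≤ Σ_{ℓ ≥ 2} c_ℓ μ_ℓ^k` of the far-field operator on the
sector `ℓ ≥ 2`; here `k = 8`, index shifted to `ℓ + 2`). Term by term `≤` the rational majorant
`T(ℓ)` (`cWeight_mul_mu_pow_eight_le`), whose partial sums are `≤ 2/3`
(`sum_legendreMajorant_le`). Registered helper. -/
theorem t12_farField_legendreCertificate : ∀ N : ℕ, ∑ ℓ ∈ Finset.range N, (2 * ((ℓ + 2 : ℕ) : ℝ) + 1) / 2 * (∫ x in (-1 : ℝ)..1, |(Literature.Analysis.SpecialFunctions.legendre (ℓ + 2)).eval x|) * (4 * ∫ ρ in (0 : ℝ)..1, ρ ^ 2 * |(Literature.Analysis.SpecialFunctions.legendre (ℓ + 2)).eval ρ|) ^ 8 ≤ 2 / 3 :=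
  fun N => (Finset.sum_le_sum fun ℓ _ => cWeight_mul_mu_pow_eight_le (ℓ + 2)).trans
    (sum_legendreMajorant_le N)

/-- The series form of FF4: `ℓ ↦ c_{ℓ+2} μ_{ℓ+2}⁸` is summable and `Σ_{ℓ ≥ 2} c_ℓ μ_ℓ⁸ ≤ 2/3`
(nonnegative terms with bounded partial sums). [folklore] -/
theorem t12_farField_legendreCertificate_tsum :
    Summable (fun ℓ : ℕ => (2 * ((ℓ + 2 : ℕ) : ℝ) + 1) / 2 *
        (∫ x in (-1 : ℝ)..1, |(legendre (ℓ + 2)).eval x|) *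
        (4 * ∫ ρ in (0 : ℝ)..1, ρ ^ 2 * |(legendre (ℓ + 2)).eval ρ|) ^ 8) ∧
      ∑' ℓ : ℕ, (2 * ((ℓ + 2 : ℕ) : ℝ) + 1) / 2 *
        (∫ x in (-1 : ℝ)..1, |(legendre (ℓ + 2)).eval x|) *
        (4 * ∫ ρ in (0 : ℝ)..1, ρ ^ 2 * |(legendre (ℓ + 2)).eval ρ|) ^ 8 ≤ 2 / 3 :=
  ⟨summable_of_sum_range_le (fun ℓ => cWeight_mul_mu_pow_eight_nonneg (ℓ + 2))
      t12_farField_legendreCertificate,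
    tsum_le_of_sum_range_le (fun ℓ => cWeight_mul_mu_pow_eight_nonneg (ℓ + 2))
      t12_farField_legendreCertificate⟩

end Summit.AtomisticToContinuum.HydrodynamicLimit.Theorems.ClampedCorrectorBirth
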